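import Summits.HodgeConjecture.HodgeConjecture.Theses.SignSymmetricPowers
import Literature.AlgebraicGeometry.HodgeTheory.DiagonalKunnethComponentCasimir
import Literature.AlgebraicGeometry.HodgeTheory.BettiUniverseCupChainMatchings
import Literature.AlgebraicGeometry.HodgeTheory.OddHypersurfaceHodgeConjecture
import Literature.AlgebraicGeometry.Motives.FibrePowerSmoothProjective
import Literature.AlgebraicGeometry.Motives.HodgeTensor
import Literature.LinearAlgebra.Alternating.SymplecticInvolutionCentralizer
import Literature.RepresentationTheory.ClassicalInvariants.SymplecticTensorFFTBlockDiagonal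

/-!
# K2-B stub A: Künneth insertions of matching tensors are algebraic (route `SignSymmetricPowers`, item stmt-HodgeConjecture-19717)

Discharges the registered stub `stub_matchingClassesAlgebraic` (statement `MatchingClassesAlgebraic`,
HOME/p3/k2line-v2-g19/sig_S_A.txt, skeleton `960d9c079ab3ffd4`, K2-B line `kunneth-tensor-fft` v2) of the
crux `PowersHodgeOfSignCommutators` of route `route-HodgeConjecture-SignSymmetricPowers`; landed
`--supports stmt-HodgeConjecture-19717` (it does not close the item). Sorry-free; conditional only on the
line's own binder, the Fulton pull-back fact `fulton1998_map_mem_algebraicClasses` (antecedent of the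
registered signature).

## Statement

For a smooth sign-symmetric hypersurface threefold `X ⊂ ℙ⁴`, a morphism `σ : X ⟶ X`, a limit fan
`(Y, π)` of `k + 1` copies of `X`, a class `wdec ∈ H^{2q}(Y; ℚ)` with algebraic complexification and a
Künneth insertion `E : T^{r,0}H³(X) → H^{2p}(Y)` given on basis tensors by the left-nested cup chain
`wdec ∪ π_{u 0}^* b_{w 0} ∪ ⋯`, the image under `E` of every MATCHING TENSOR
`Σ_w (∏ₘ Θ_{τ m}[w(e⁻¹(0,m)), w(e⁻¹(1,m))]) · ⊗ᵢ b_{w i}` (`e` a pairing of the `r` slots, tags `τ`,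
`Θ_ε = [½(1 ± σ^*)]_b · Q⁻¹`, `Q = (tr(bᵢ ∪ bⱼ))`) has algebraic complexification on `Y`.

## Proof

`E` is linear, so the image is the contraction `Σ_w (∏ Θ) · E(⊗ b_w)` of the cup chains, which the tree's
re-summation theorem `BettiUniverse.ofRatClass_sum_smul_cupChain_mem_algebraicClasses`
(`BettiUniverseCupChainMatchings`) reduces to the algebraicity of the two-slot insertions
`Σ_{i,i'} Θ_ε[i,i'] f^*bᵢ ∪ g^*b_{i'}` (`f, g : Y ⟶ X`). Absorbing the matrix `[½(1 ± σ^*)]_b` into the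
first slot (`sum_toMatrix_mul_smul_eq`), these are `½((f,g)^*κ ± (f ≫ σ, g)^*κ)` for the Poincaré Casimir
`κ = Σ (Q⁻¹)ᵢⱼ pr₁^*bᵢ ∪ pr₂^*bⱼ` of `H³(X; ℚ)` on `X × X` (`sum_casimir_pull_eq`), whose complexification
is algebraic by `ofRatClass_casimir_mem_algebraicClasses` (`DiagonalKunnethComponentCasimir`: the middle
Künneth component of the diagonal; the hypersurface threefold has `H¹ = H⁵ = 0` and algebraic even
cohomology, `HypersurfaceCutOutByLefschetz`); pull-backs preserve algebraicity by the Fulton binder.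

## References

* C. Voisin, *Hodge Theory and Complex Algebraic Geometry I* (2002), §11.3.3 (Künneth components of the
  diagonal); II (2003), Prop. 9.20–9.21. [cite: VoisinHodgeI2002] [cite: VoisinHodgeII2003]
* W. Fulton, *Intersection Theory* (1998), §19.2 Cor. 19.2 (b) (the binder). [cite: Fulton1998]
-/

noncomputable section

open Finset
open CategoryTheory CategoryTheory.Limits MonoidalCategory CartesianMonoidalCategory
open Literature.AlgebraicGeometry.Motives Literature.AlgebraicGeometry.HodgeTheory
open Literature.AlgebraicGeometry.HodgeTheory.BettiUniverse
open Literature.RepresentationTheory.ClassicalInvariants Literature.LinearAlgebra.Alternating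

namespace Summit.HodgeConjecture.HodgeConjecture.Theorems.SignSymmetricPowersMatchingClassesAlgebraic

variable {X Y : SchemeOver ℂ}

/-! ### §1 Two-slot insertions: pull-backs of the Casimir, matrix absorption -/

/-- **Two-slot insertions are pull-backs of the exterior class**: for `f, g : Y ⟶ X` and coefficients `c`,
`Σ_{i,i'} cᵢᵢ' · f^*vᵢ ∪ g^*v'ᵢ' = (f, g)^*(Σ cᵢᵢ' · pr₁^*vᵢ ∪ pr₂^*v'ᵢ')` (naturality of the cup product,
`(f,g) ≫ pr₁ = f`, `(f,g) ≫ pr₂ = g`). [cite: VoisinHodgeII2003, proof of Prop. 9.20 (second display)] -/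
theorem sum_smul_bettiCup_pull_eq_pull_lift {n m : ℕ} (h : n + n = m) {ι : Type*} [Fintype ι]
    (c : ι → ι → ℚ) (v v' : ι → bettiCohomology X n) (f g : Y ⟶ X) :
    ∑ i, ∑ i', c i i' • bettiCup h (pull f n (v i)) (pull g n (v' i')) =
      pull (lift f g) m (∑ i, ∑ i', c i i' • bettiCup h (pull (fst X X) n (v i)) (pull (snd X X) n (v' i'))) := by
  simp only [map_sum, map_smul]
  refine Finset.sum_congr rfl fun i _ ↦ Finset.sum_congr rfl fun i' _ ↦ ?_
  congr 1
  change _ = bettiCohomology.map (lift f g) m (bettiCup h _ _)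
  rw [bettiCup_map]
  change _ = bettiCup h (pull (lift f g) n (pull (fst X X) n (v i))) (pull (lift f g) n (pull (snd X X) n (v' i')))
  rw [← LinearMap.comp_apply (f := pull (lift f g) n), ← pull_comp, lift_fst,
    ← LinearMap.comp_apply (f := pull (lift f g) n), ← pull_comp, lift_snd]

/-- **Absorbing the matrix of an endomorphism into the first slot**: for `φ ∈ End(V)` with matrix `[φ]_b`
and a bilinear `B₂`, `Σ_{i,i'} ([φ]_b · C)ᵢᵢ' · B₂(bᵢ, bᵢ') = Σ_{j,i'} Cⱼᵢ' · B₂(φ bⱼ, bᵢ')`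
(`φ bⱼ = Σᵢ [φ]ᵢⱼ bᵢ`). [cite: GoodmanWallachGTM255, §5.3.2 (before Thm. 5.3.5)] -/
theorem sum_toMatrix_mul_smul_eq {V W : Type*} [AddCommGroup V] [Module ℚ V] [AddCommGroup W] [Module ℚ W]
    {ι : Type*} [Fintype ι] [DecidableEq ι] (b : Module.Basis ι ℚ V) (φ : V →ₗ[ℚ] V) (C : Matrix ι ι ℚ)
    (B₂ : V →ₗ[ℚ] V →ₗ[ℚ] W) :
    ∑ i, ∑ i', (LinearMap.toMatrix b b φ * C) i i' • B₂ (b i) (b i') =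
      ∑ j, ∑ i', C j i' • B₂ (φ (b j)) (b i') := by
  have hφ : ∀ j, φ (b j) = ∑ i, LinearMap.toMatrix b b φ i j • b i := by
    intro j
    conv_lhs => rw [← b.sum_repr (φ (b j))]
    simp only [LinearMap.toMatrix_apply]
  -- both sides equal `Σ_{i,i',j} [φ]ᵢⱼ Cⱼᵢ' · B₂(bᵢ, bᵢ')`
  have hL : ∑ i, ∑ i', (LinearMap.toMatrix b b φ * C) i i' • B₂ (b i) (b i') =
      ∑ i, ∑ i', ∑ j, (LinearMap.toMatrix b b φ i j * C j i') • B₂ (b i) (b i') := by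
    simp only [Matrix.mul_apply, Finset.sum_smul]
  have hR : ∑ j, ∑ i', C j i' • B₂ (φ (b j)) (b i') =
      ∑ j, ∑ i', ∑ i, (LinearMap.toMatrix b b φ i j * C j i') • B₂ (b i) (b i') := by
    refine Finset.sum_congr rfl fun j _ ↦ Finset.sum_congr rfl fun i' _ ↦ ?_
    rw [hφ, LinearMap.map_sum₂, Finset.smul_sum]
    refine Finset.sum_congr rfl fun i _ ↦ ?_
    rw [LinearMap.map_smul₂, smul_smul, mul_comm]
  rw [hL, hR, Finset.sum_comm]
  conv_rhs => rw [Finset.sum_comm]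
  refine Finset.sum_congr rfl fun i' _ ↦ ?_
  rw [Finset.sum_comm]

/-! ### §2 The stub -/

/-- **`stub_matchingClassesAlgebraic`** (K2-B line `kunneth-tensor-fft` v2, registered signature verbatim):
granted Fulton's pull-back fact, the Künneth insertion `E t` of every matching tensor `t` of
`T^{r,0}H³(X; ℚ)` (pairing `e`, tags `τ`, Casimirs of the trace form twisted by `½(1 ± σ^*)`) has
algebraic complexification on the fibre power `Y` of the sign-symmetric hypersurface threefold `X`.
[cite: VoisinHodgeI2002, §11.3.3 Thm. 11.38 and Lemma 11.41] [cite: VoisinHodgeII2003, proof of Prop. 9.20 and Prop. 9.21 (i)]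
[cite: Fulton1998, §19.2 Cor. 19.2 (b)] -/
theorem stub_matchingClassesAlgebraic :
    open Literature.AlgebraicGeometry.Motives Literature.AlgebraicGeometry.HodgeTheory Literature.AlgebraicGeometry.HodgeTheory.BettiUniverse CategoryTheory.Limits in Literature.AlgebraicGeometry.HodgeTheory.fulton1998_map_mem_algebraicClasses → ∀ ⦃d : ℕ⦄, Even d → 4 ≤ d → ∀ ⦃X : SchemeOver ℂ⦄ (hX : IsSmoothProjective 3 X), (∃ f : MvPolynomial (Fin 5) ℂ, f.IsHomogeneous d ∧ (∀ e : Fin 5 →₀ ℕ, ¬ Even (e 0 + e 1) → f.coeff e = 0) ∧ IsHypersurfaceCutOutBy 4 f X) → ∀ [Module.Finite ℚ (bettiCohomology X 3)] (σ : X ⟶ X) ⦃k : ℕ⦄ ⦃Y : SchemeOver ℂ⦄ (π : Fin (k + 1) → (Y ⟶ X)) (hlim : IsLimit (Fan.mk Y π)) (p q r : ℕ) (u : Fin r → Fin (k + 1)) (wdec : bettiCohomology Y (2 * q)), ofRatClass (ComplexPoints Y) (2 * q) wdec ∈ algebraicClasses Y q → ∀ (E : hodgeTensorSpace (bettiCohomology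 X 3) r 0 →ₗ[ℚ] bettiCohomology Y (2 * p)), (∀ w : Fin r → Fin (Module.finrank ℚ (bettiCohomology X 3)), (⟨2 * p, E ((PiTensorProduct.tprod ℚ fun i => (Module.finBasis ℚ (bettiCohomology X 3)) (w i)) ⊗ₜ[ℚ] (PiTensorProduct.tprod ℚ fun i : Fin 0 => (Fin.elim0 i : Module.Dual ℚ (bettiCohomology X 3))))⟩ : Σ n, bettiCohomology Y n) = List.foldl (fun (acc : Σ n, bettiCohomology Y n) (i : Fin r) => ⟨acc.1 + 3, cup Y acc.1 3 acc.2 (pull (π (u i)) 3 ((Module.finBasis ℚ (bettiCohomology X 3)) (w i)))⟩) ⟨2 * q, wdec⟩ (List.finRange r)) → ∀ (j : ℕ) (e : Fin r ≃ Fin 2 × Fin j) (τ : Fin j → Bool), ofRatClass (ComplexPoints Y) (2 * p) (E (∑ w : Fin r → Fin (Module.finrank ℚ (bettiCohomology X 3)), Literature.RepresentationTheory.ClassicalInvariants.taggedContraction (fun ε : Bool => LinearMap.toMatrix (Module.finBasis ℚ (bettiCohomology X 3)) (Module.finBasis ℚ (bettiCohomology X 3)) (Literature.LinearAlgebra.Alternating.halfProj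 (if ε then (pull σ 3) else -(pull σ 3))) * (Matrix.of fun i i' => ((cup X 3 3).compr₂ (tr hX (3 + 3))) ((Module.finBasis ℚ (bettiCohomology X 3)) i) ((Module.finBasis ℚ (bettiCohomology X 3)) i'))⁻¹) e τ w • ((PiTensorProduct.tprod ℚ fun i => (Module.finBasis ℚ (bettiCohomology X 3)) (w i)) ⊗ₜ[ℚ] (PiTensorProduct.tprod ℚ fun i : Fin 0 => (Fin.elim0 i : Module.Dual ℚ (bettiCohomology X 3)))))) ∈ algebraicClasses Y p := by
  intro hP d _hd _h4 X hX hf _inst σ k Y π hlim p q r u wdec hwdec E hE j e τ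
  classical
  obtain ⟨f, hfd, -, hcut⟩ := hf
  have hf0 : f ≠ 0 := hX.ne_zero_of_isHypersurfaceCutOutBy hcut
  have hY : IsSmoothProjective (3 * (k + 1)) Y := isSmoothProjective_of_isLimit_fan hX π hlim
  have hXX : IsSmoothProjective (3 + 3) (X ⊗ X) := hX.tensor_holds hX
  have h2 : 3 + 3 = 2 * 3 := rfl
  set b := Module.finBasis ℚ (bettiCohomology X 3) with hb
  set Q : Matrix (Fin (Module.finrank ℚ (bettiCohomology X 3))) (Fin (Module.finrank ℚ (bettiCohomology X 3))) ℚ :=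
    Matrix.of fun i i' ↦ ((cup X 3 3).compr₂ (tr hX (3 + 3))) (b i) (b i') with hQ
  -- the Poincaré Casimir of `H³(X; ℚ)` on `X × X` is algebraic
  have hκ : ofRatClass (ComplexPoints (X ⊗ X)) (2 * 3)
      (∑ i, ∑ i', Q⁻¹ i i' • bettiCup h2 (pull (fst X X) 3 (b i)) (pull (snd X X) 3 (b i'))) ∈
      algebraicClasses (X ⊗ X) 3 :=
    ofRatClass_casimir_mem_algebraicClasses hX
      (fun j hj hjn ↦ subsingleton_bettiCohomology_of_odd (n := 3) hX hfd hf0 hcut hj hjn)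
      (fun a z _ ↦ by rw [algebraicClasses_eq_top_threefold hX hfd hf0 hcut a]; exact Submodule.mem_top) b h2
  -- its two-slot pull-backs are algebraic
  have hT : ∀ f' g' : Y ⟶ X, ofRatClass (ComplexPoints Y) (2 * 3)
      (∑ i, ∑ i', Q⁻¹ i i' • bettiCup h2 (pull f' 3 (b i)) (pull g' 3 (b i'))) ∈ algebraicClasses Y 3 := by
    intro f' g'
    rw [sum_smul_bettiCup_pull_eq_pull_lift h2]
    exact ofRatClass_pull_mem_algebraicClasses hP hXX hY (lift f' g') hκ
  -- the two-slot insertions of the tagged matrices are algebraic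
  have hΘ : ∀ (mm : Fin j) (f' g' : Y ⟶ X), ofRatClass (ComplexPoints Y) (2 * 3)
      (∑ i, ∑ i', ((fun ε : Bool => LinearMap.toMatrix b b
          (halfProj (if ε then (pull σ 3) else -(pull σ 3))) * Q⁻¹) (τ mm)) i i' •
        bettiCup h2 (pull f' 3 (b i)) (pull g' 3 (b i'))) ∈ algebraicClasses Y 3 := by
    intro mm f' g'
    have habs := sum_toMatrix_mul_smul_eq b (halfProj (if τ mm then (pull σ 3) else -(pull σ 3))) Q⁻¹
      ((bettiCup h2).compl₁₂ (pull f' 3) (pull g' 3))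
    simp only [LinearMap.compl₁₂_apply] at habs
    dsimp only
    rw [habs]
    have hsplit : ∀ jj, halfProj (if τ mm then (pull σ 3) else -(pull σ 3)) (b jj) =
        (2 : ℚ)⁻¹ • b jj + ((2 : ℚ)⁻¹ * (if τ mm then 1 else -1)) • pull (f := σ) 3 (b jj) := by
      intro jj
      rw [halfProj_apply]
      cases τ mm
      · simp only [Bool.false_eq_true, if_false, LinearMap.neg_apply, smul_add, smul_neg, mul_neg, mul_one,
          neg_smul]
      · simp only [if_true, smul_add, mul_one]
    have hcomp : ∀ jj, pull f' 3 (pull σ 3 (b jj)) = pull (f' ≫ σ) 3 (b jj) := by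
      intro jj; rw [pull_comp]; rfl
    simp only [hsplit, map_add, map_smul, LinearMap.add_apply, LinearMap.smul_apply, smul_add, smul_smul,
      Finset.sum_add_distrib, hcomp]
    have hpull : ∀ (c : ℚ) (f'' : Y ⟶ X),
        ∑ x, ∑ x_1, (Q⁻¹ x x_1 * c) • bettiCup h2 (pull f'' 3 (b x)) (pull g' 3 (b x_1)) =
          c • ∑ x, ∑ x_1, Q⁻¹ x x_1 • bettiCup h2 (pull f'' 3 (b x)) (pull g' 3 (b x_1)) := by
      intro c f''
      rw [Finset.smul_sum]
      refine Finset.sum_congr rfl fun x _ ↦ ?_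
      rw [Finset.smul_sum]
      refine Finset.sum_congr rfl fun x_1 _ ↦ ?_
      rw [smul_smul]
      congr 1
      exact mul_comm _ _
    rw [hpull, hpull]
    have hsm : ∀ (c : ℚ) (z : bettiCohomology Y (2 * 3)),
        ofRatClass (ComplexPoints Y) (2 * 3) (c • z) = (c : ℂ) • ofRatClass (ComplexPoints Y) (2 * 3) z :=
      fun c z ↦ Literature.AlgebraicGeometry.Motives.ofRatClass_smul _ _ c z
    rw [hsm, hsm]
    exact Submodule.add_mem _ (Submodule.smul_mem _ _ (hT f' g')) (Submodule.smul_mem _ _ (hT (f' ≫ σ) g'))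
  -- the re-summation theorem
  rw [map_sum E]
  simp only [map_smul, taggedContraction_apply]
  exact ofRatClass_sum_smul_cupChain_mem_algebraicClasses hP hY h2 b π u q wdec hwdec p
    (fun w ↦ E ((PiTensorProduct.tprod ℚ fun i => b (w i)) ⊗ₜ[ℚ]
      (PiTensorProduct.tprod ℚ fun i : Fin 0 => (Fin.elim0 i : Module.Dual ℚ (bettiCohomology X 3)))))
    hE e (fun mm ↦ (fun ε : Bool => LinearMap.toMatrix b b (halfProj (if ε then (pull σ 3) else -(pull σ 3))) * Q⁻¹)
      (τ mm)) hΘ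

end Summit.HodgeConjecture.HodgeConjecture.Theorems.SignSymmetricPowersMatchingClassesAlgebraic

end
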